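import Summits.QuantumFields.YangMills.Theorems.DiagonalMirrorRPROddTorusSwapPairingDefs
import Summits.QuantumFields.YangMills.Theorems.DiagonalMirrorRPRTwistLettersDefs

/-!
# Crux `WeakCouplingHypercubicLimitRP` (stmt-QuantumFields-27395 / twin -27398), crux idea `brick-twist-axis-transfer`:
# first lemmas (signatures only; nothing is proved here)

The 45° (Fröhlich–Israel–Lieb–Simon) double cover `T̃_N` of the scheme's own odd torus `T_N = ℤ⁴/Nℤ⁴`
(`N = sch.side k = 2L_k+1`) is reached from `T_N` through the BRICK `B_N = ℤ⁴/⟨2Ne₀, Ne₁, Ne₂, Ne₃⟩`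
(the tree's UNSHEARED box torus `TSite (2N) N N`, `texp ρ β false`) in two boundaryless steps:

* PD (period doubling)  `T_N → B_N`: same `e₀`-transfer matrix `𝒯₀` on the slice `ℤ_N³`,
  `Z(T_N) = Tr 𝒯₀^N`, `Z(B_N) = Tr 𝒯₀^{2N}`;
* TW (half-period twist) `B_N → T̃_N`: `Λ̃_N = ⟨2Ne₀, N(e₀+e₁), Ne₂, Ne₃⟩`, i.e. `T̃_N` is `B_N` with its `e₁`-wrap
  glued after the translation by `N e₀`; same `e₁`-transfer matrix `𝒯₁` on the slice `ℤ_{2N} × ℤ_N²`,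
  `Z(B_N) = Tr 𝒯₁^N`, `Z(T̃_N) = Tr (𝒯₁^N 𝒰)`, `𝒰` = translation by `N e₀` (unitary, `[𝒰, 𝒯₁] = 0`, `𝒰Ω = Ω`)
  — a Giusti–Meyer shifted boundary condition.

With the thermal-saturation letter `AxisThermalSaturation` (`Z ≤ λ₀^m (1 + C e^{-Δ' a_k N})` on the two slices) the
spectral decomposition `𝒯 = λ₀ (P_Ω + R)`, `P_Ω R = 0`, `0 ≤ R`, `Tr R^m = Z_m/λ₀^m - 1` gives, for every bounded local
cylinder observable `A` of lattice radius `w ≤ N/4`,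
`|⟨A⟩_{T_N} - ⟨A⟩_{B_N}|, |⟨A⟩_{B_N} - ⟨A⟩_{T̃_N}| ≤ C ‖A‖_∞ e^{-Δ' a_k N}` (`PeriodDoublingExp`, `TwistExp`) — no boundary
state, no free energy deficit, no odd sector.  On `T̃_N` swap reflection positivity is EXACT (landed `CoverSwapRPAt`,
`stub_fortyFiveSwapRP`, `lattice_psd`), so the own-torus Gram pairings of the socket are `≥ -o(1)`:
`OddTorusSwapPairingLiminf r sch` (D1″ ⟺ D1′, `Disproof.lean` §6).
-/

set_option autoImplicit false

noncomputable section

open scoped SchwartzMap ComplexConjugate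
open MeasureTheory Filter Topology
open Literature.MathematicalPhysics.QuantumLattice Literature.MathematicalPhysics.AQFT
  Literature.MathematicalPhysics.QuantumFieldTheory Literature.Probability.LatticeModels
open Summit.QuantumFields.YangMills.Cruxes.DiagonalMirrorRPR.ParityBridgeColdTraces
  (E4 TSite TEdge TConfig tstep texp tZ skewLift coverSchwinger CoverInsensitivity)
open Summit.QuantumFields.YangMills.Cruxes.DiagonalMirrorRPR.SignTwistedDiagonalTrace
  (ReflectedFamily gramPairing OddTorusSwapPairingLiminf Growth TemperateRenormalisation SideGrowth)

namespace Summit.QuantumFields.YangMills.Cruxes.WeakCouplingHypercubicLimitRP.BrickTwist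

/-! ## §1 The brick `B_N = ℤ⁴/⟨2Ne₀, Ne₁, Ne₂, Ne₃⟩` (unsheared `TSite (2N) N N`) and its lift -/

section Brick

variable {G : Type} [Group G] [TopologicalSpace G] [IsTopologicalGroup G] [CompactSpace G]
  [MeasurableSpace G] [BorelSpace G]

/-- Straight reduction `ℤ⁴ → ℤ_{2N} × ℤ_N × ℤ_N × ℤ_N` (kernel `⟨2Ne₀, Ne₁, Ne₂, Ne₃⟩`): the brick `B_N` in the SAME
chart type as the tree's 45° cover (`skewProj` is the sheared reduction `x ↦ (x₀ - x₁, x₁, x₂, x₃)`). -/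
def boxProj (N : ℕ) (x : Fin 4 → ℤ) : TSite (2 * N) N N :=
  (((x 0 : ℤ) : ZMod (2 * N)), ((x 1 : ℤ) : ZMod N), ((x 2 : ℤ) : ZMod N), ((x 3 : ℤ) : ZMod N))

/-- The `⟨2Ne₀, Ne₁, Ne₂, Ne₃⟩`-periodic lift of a brick configuration to `ℤ⁴` (analogue of `torusLift`, `skewLift`). -/
def boxLift (N : ℕ) (U : TConfig (2 * N) N N G) : LGConfig 4 G := fun e => U (boxProj N e.1, e.2)

/-- Brick `n`-point function at step `k`: the integrand, smearing box, spacing and renormalisations of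
`latticeSchwinger` VERBATIM, integrated against Wilson's measure of the brick `B_{N_k}` (`texp ρ β false`). -/
def boxSchwinger (r : LatticeRep G) (sch : SpeciesScheme (YMSpecies G)) (k n : ℕ) (f : Fin n → 𝓢(E4, ℝ)) : ℝ :=
  (texp r.ρ (sch.β k) false fun U : TConfig (2 * sch.side k) (sch.side k) (sch.side k) G =>
    ((∏ i, smearedLatticeField r.curvature.F (box 4 (sch.L k)) (sch.a k) (sch.c r.curvature k)
        (sch.m r.curvature k) (f i) (boxLift (sch.side k) U) : ℝ) : ℂ)).re

/-- Brick Gram pairing of a reflected family (the socket's `gramPairing` with the brick `n`-point functions). -/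
def boxGramPairing (r : LatticeRep G) (sch : SpeciesScheme (YMSpecies G)) (F : ReflectedFamily) (k : ℕ) : ℝ :=
  ∑ i, ∑ i', F.c i * F.c i' * boxSchwinger r sch k (F.n i + F.n i') (Fin.append (F.σf i) (F.f i'))

/-- Cover Gram pairing of a reflected family (landed `coverSchwinger` on the 45° cover `T̃_{N_k}`). -/
def coverGramPairing (r : LatticeRep G) (sch : SpeciesScheme (YMSpecies G)) (F : ReflectedFamily) (k : ℕ) : ℝ :=
  ∑ i, ∑ i', F.c i * F.c i' * coverSchwinger r sch k (F.n i + F.n i') (Fin.append (F.σf i) (F.f i'))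

/-! ## §2 The two letters at Gram level (what the socket consumes) -/

/-- **PD — period-doubling decoupling.**  Own odd torus `T_{N_k}` versus brick `B_{N_k}` (e₀-period `N_k` vs `2N_k`,
same `e₀`-slice `ℤ_{N_k}³`): the socket's Gram pairings differ by `o(1)`. -/
def PeriodDoublingDecoupling (r : LatticeRep G) (sch : SpeciesScheme (YMSpecies G)) : Prop :=
  ∀ F : ReflectedFamily,
    (∀ i (j j' : Fin (F.n i)), j ≠ j' → Disjoint (tsupport (F.f i j : E4 → ℝ)) (tsupport (F.f i j' : E4 → ℝ))) →
      Tendsto (fun k : ℕ => gramPairing r sch F k - boxGramPairing r sch F k) atTop (𝓝 0)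

/-- **TW — half-period twist decoupling.**  Brick `B_{N_k}` versus 45° cover `T̃_{N_k}` (= `B_{N_k}` with the `e₁`-wrap
twisted by the translation `N_k e₀`; same `e₁`-slice `ℤ_{2N_k} × ℤ_{N_k}²`): the Gram pairings differ by `o(1)`. -/
def TwistDecoupling (r : LatticeRep G) (sch : SpeciesScheme (YMSpecies G)) : Prop :=
  ∀ F : ReflectedFamily,
    (∀ i (j j' : Fin (F.n i)), j ≠ j' → Disjoint (tsupport (F.f i j : E4 → ℝ)) (tsupport (F.f i j' : E4 → ℝ))) →
      Tendsto (fun k : ℕ => boxGramPairing r sch F k - coverGramPairing r sch F k) atTop (𝓝 0)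

/-! ## §3 The letters in sup-norm currency for bounded local cylinder observables (what the transfer matrix gives) -/

/-- A bounded measurable cylinder observable of lattice radius `w` about the origin of `ℤ⁴`. -/
def IsLocalObs (w : ℕ) (B : ℝ) (A : LGConfig 4 G → ℝ) : Prop :=
  Measurable A ∧ (∀ V, |A V| ≤ B) ∧ DependsOn A {e : (Fin 4 → ℤ) × Fin 4 | ∀ μ, |e.1 μ| ≤ w}

/-- **PD, exponential form.**  `|⟨A⟩_{T_N} - ⟨A⟩_{B_N}| ≤ C·B·e^{-Δ' a_k N_k}` for local observables of radius `≤ N_k/4`. -/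
def PeriodDoublingExp (r : LatticeRep G) (sch : SpeciesScheme (YMSpecies G)) : Prop :=
  ∃ Δ' C : ℝ, 0 < Δ' ∧ ∀ᶠ k in atTop, ∀ (w : ℕ) (B : ℝ) (A : LGConfig 4 G → ℝ), 4 * w ≤ sch.side k →
    IsLocalObs w B A →
      |(∫ U, A (torusLift (sch.side k) U) ∂(wilsonMeasure (d := 4) (L := sch.side k) r.ρ (sch.β k))) -
          (texp r.ρ (sch.β k) false fun U : TConfig (2 * sch.side k) (sch.side k) (sch.side k) G =>
            ((A (boxLift (sch.side k) U) : ℝ) : ℂ)).re|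
        ≤ C * B * Real.exp (-(Δ' * sch.a k * sch.side k))

/-- **TW, exponential form.**  `|⟨A⟩_{B_N} - ⟨A⟩_{T̃_N}| ≤ C·B·e^{-Δ' a_k N_k}` for local observables of radius `≤ N_k/4`. -/
def TwistExp (r : LatticeRep G) (sch : SpeciesScheme (YMSpecies G)) : Prop :=
  ∃ Δ' C : ℝ, 0 < Δ' ∧ ∀ᶠ k in atTop, ∀ (w : ℕ) (B : ℝ) (A : LGConfig 4 G → ℝ), 4 * w ≤ sch.side k →
    IsLocalObs w B A →
      |(texp r.ρ (sch.β k) false fun U : TConfig (2 * sch.side k) (sch.side k) (sch.side k) G =>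
            ((A (boxLift (sch.side k) U) : ℝ) : ℂ)).re -
          (texp r.ρ (sch.β k) true fun U : TConfig (2 * sch.side k) (sch.side k) (sch.side k) G =>
            ((A (skewLift (sch.side k) U) : ℝ) : ℂ)).re|
        ≤ C * B * Real.exp (-(Δ' * sch.a k * sch.side k))

/-! ## §4 The spectral supplier: axis thermal saturation of the brick partition functions (TTG) -/

variable {Nc : ℕ}

/-- `λ₀` of the `e₀`-transfer matrix on the slice `ℤ_N³`: `inf_m Z(ℤ_m × ℤ_N³)^{1/m}` (`= lim`, `= top eigenvalue`). -/
def topE0 (ρ : G →* Matrix (Fin Nc) (Fin Nc) ℂ) (β : ℝ) (N : ℕ) [NeZero N] : ℝ :=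
  ⨅ m : ℕ, tZ ρ (m + 1) N N β false ^ ((1 : ℝ) / (m + 1))

/-- `λ₀` of the `e₁`-transfer matrix on the slice `ℤ_{2N} × ℤ_N²`: `inf_m Z(ℤ_{2N} × ℤ_m × ℤ_N²)^{1/m}`. -/
def topE1 (ρ : G →* Matrix (Fin Nc) (Fin Nc) ℂ) (β : ℝ) (N : ℕ) [NeZero N] : ℝ :=
  ⨅ m : ℕ, tZ ρ (2 * N) (m + 1) N β false ^ ((1 : ℝ) / (m + 1))

/-- **TTG — axis thermal saturation** (the letter in partition-function currency).  On the two brick slices the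
torus partition function at axial extent `m_k = L_k + 1 ≈ N_k/2` is vacuum-saturated up to an exponentially small
thermal correction: `Z(m_k) ≤ λ₀^{m_k} (1 + C e^{-Δ' a_k N_k})`, i.e. `Tr ((𝒯/λ₀)^{m_k} (1 - P_Ω)) ≤ C e^{-Δ' a_k N_k}`
(simplicity of `λ₀` + gap + polynomial density of states, in one inequality). -/
def AxisThermalSaturation (r : LatticeRep G) (sch : SpeciesScheme (YMSpecies G)) : Prop :=
  ∃ Δ' C : ℝ, 0 < Δ' ∧ ∀ᶠ k in atTop,
    tZ r.ρ (sch.L k + 1) (sch.side k) (sch.side k) (sch.β k) false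
        ≤ topE0 r.ρ (sch.β k) (sch.side k) ^ (sch.L k + 1) * (1 + C * Real.exp (-(Δ' * sch.a k * sch.side k))) ∧
    tZ r.ρ (2 * sch.side k) (sch.L k + 1) (sch.side k) (sch.β k) false
        ≤ topE1 r.ρ (sch.β k) (sch.side k) ^ (sch.L k + 1) * (1 + C * Real.exp (-(Δ' * sch.a k * sch.side k)))

end Brick

/-! ## §5 First lemmas of the line (signatures; sizes M−, M, L) -/

/-- **L1 (M−).**  The socket from the two Gram-level letters: on the cover the Gram sums are `≥ 0` EXACTLY
(landed `CoverSwapRPAt` for `β ≥ 0`, `N ≥ 2` + `lattice_psd`), and PD + TW move them to the own torus up to `o(1)`. -/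
def SocketOfDecoupling : Prop :=
  ∀ (G : Type) [Group G] [TopologicalSpace G] [IsTopologicalGroup G] [CompactSpace G]
    [MeasurableSpace G] [BorelSpace G] (r : LatticeRep G) (sch : SpeciesScheme (YMSpecies G)),
    (∀ᶠ k in atTop, 0 ≤ sch.β k) → (∀ᶠ k in atTop, 2 ≤ sch.side k) →
      PeriodDoublingDecoupling r sch → TwistDecoupling r sch → OddTorusSwapPairingLiminf r sch

/-- **L2 (M).**  Gram-level letters from the exponential ones: a socket Gram observable is a local cylinder observable of
lattice radius `O(ρ_F / a_k) ≤ N_k/4` eventually with sup norm `≤ K (a_k⁻¹)^P (a_k N_k)^Q` (`famObs_supGrowth`), and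
`(a_k⁻¹)^P (a_k N_k)^Q e^{-Δ' a_k N_k} → 0` by `SideGrowth` (`Growth = TemperateRenormalisation ∧ SideGrowth`). -/
def DecouplingOfExp : Prop :=
  ∀ (G : Type) [Group G] [TopologicalSpace G] [IsTopologicalGroup G] [CompactSpace G]
    [MeasurableSpace G] [BorelSpace G] (r : LatticeRep G) (sch : SpeciesScheme (YMSpecies G)),
    Growth r sch → PeriodDoublingExp r sch → TwistExp r sch →
      PeriodDoublingDecoupling r sch ∧ TwistDecoupling r sch

/-- **L3 (L) — the transfer-matrix theorem.**  TTG on the two brick slices gives both exponential letters: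
`𝒯 = λ₀ (P_Ω + R)`, `Tr R^m ≤ C e^{-Δ' a N}`; PD: `Tr 𝒯₀^N` vs `Tr 𝒯₀^{2N}` with the insertion bound
`‖𝒳_A‖ ≤ ‖A‖_∞ λ₀^w`; TW: `Tr 𝒯₁^N` vs `Tr (𝒯₁^N 𝒰)`, `[𝒰, 𝒯₁] = 0`, `𝒰 Ω = Ω` (Perron–Frobenius). `β ≥ 0` makes
`𝒯 ≥ 0` (Osterwalder–Seiler). -/
def ExpOfThermalSaturation : Prop :=
  ∀ (G : Type) [Group G] [TopologicalSpace G] [IsTopologicalGroup G] [CompactSpace G]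
    [MeasurableSpace G] [BorelSpace G] (r : LatticeRep G) (sch : SpeciesScheme (YMSpecies G)),
    (∀ᶠ k in atTop, 0 ≤ sch.β k) → AxisThermalSaturation r sch → PeriodDoublingExp r sch ∧ TwistExp r sch

/-- The line's composition target, for the record: the three lemmas and the letter TTG exported by the existence heart
give the socket (D1″), which the landed transfer `diagRPOfPlaneLimits_of_swapPairingLiminf` (p827255) turns into D1. -/
def LineTarget : Prop :=
  ∀ (G : Type) [Group G] [TopologicalSpace G] [IsTopologicalGroup G] [CompactSpace G]
    [MeasurableSpace G] [BorelSpace G] (r : LatticeRep G) (sch : SpeciesScheme (YMSpecies G)),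
    sch.HasWeakCouplingLimit → Growth r sch → AxisThermalSaturation r sch → OddTorusSwapPairingLiminf r sch

/-- Sanity of the composition (pure logic): L1 + L2 + L3 and the two eventual scheme facts give `LineTarget`. -/
theorem lineTarget_of (h1 : SocketOfDecoupling) (h2 : DecouplingOfExp) (h3 : ExpOfThermalSaturation)
    (hβ : ∀ (G : Type) [Group G] [TopologicalSpace G] [IsTopologicalGroup G] [CompactSpace G]
      [MeasurableSpace G] [BorelSpace G] (sch : SpeciesScheme (YMSpecies G)),
      sch.HasWeakCouplingLimit → ∀ᶠ k in atTop, 0 ≤ sch.β k)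
    (hside : ∀ (G : Type) [Group G] [TopologicalSpace G] [IsTopologicalGroup G] [CompactSpace G]
      [MeasurableSpace G] [BorelSpace G] (r : LatticeRep G) (sch : SpeciesScheme (YMSpecies G)),
      Growth r sch → ∀ᶠ k in atTop, 2 ≤ sch.side k) :
    LineTarget := by
  intro G _ _ _ _ _ _ r sch hw hg hT
  obtain ⟨hPD, hTW⟩ := h2 G r sch hg (h3 G r sch (hβ G sch hw) hT).1 (h3 G r sch (hβ G sch hw) hT).2
  exact h1 G r sch (hβ G sch hw) (hside G r sch hg) hPD hTW

end Summit.QuantumFields.YangMills.Cruxes.WeakCouplingHypercubicLimitRP.BrickTwist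

end
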